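import Literature.AnabelianGeometry.AbsoluteAnabelian.AbsTopIII.PadicEmbeddingRigidity
import Literature.NumberTheory.GaloisRepresentations.AbsGaloisGroup
import Literature.NumberTheory.EllipticCurves.FormalGroupChart
import Mathlib.NumberTheory.Padics.Complex
import HarnessLib

/-!
# K3 `SignedKatoDivisibilityUpToAtTwo`, line `colemanrat` — FRAME-A bricks: rigidity of the `p`-adic completion frame

Cell `pub/bsd-wall`, width seat `bsd-wall-tp2-p2x-w3` g11, `--supports stmt-BirchSwinnertonDyer-20308` (helper; closes
nothing). Kernel bricks for Step A of the lead's costed upgrade «F∃ → F∀» (memo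
`Cruxes/SignedKatoDivisibilityUpToAtTwo/G9-LEAD-AUDIT.md` §4) of the named fact
`Kato2004.exists_eulerSystem_expStar_tatePairing_values_two` (p640688), whose (KZ) clause quantifies over EVERY continuous
`2`-adic completion frame `Φ : ℚ̄₂ ≅ \overline{ℚ_v}` over `φ : ℚ₂ ≅ ℚ_v`:

* `padicRingEquiv_eq` — `φ` is UNIQUE: any two ring isomorphisms `ℚ_p ≃+* K` coincide (from the tree's rigidity theorem
  `Literature.AnabelianGeometry.AbsoluteAnabelian.AbsTopIII.padicRingHom_self_eq_id`, `Aut(ℚ_p) = 1`);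
* `exists_gal_frameChange` — two frames `Φ, Φ₀` over ring isomorphisms `φ, φ₀ : ℚ_p ≃+* K` differ by an element of the absolute
  Galois group: `∃ ψ ∈ G_{ℚ_p}, Φ₀ (ψ • x) = Φ x`;
* `norm_gal_smul`, `valuation_gal_smul`, `continuous_gal_smul`, `gal_smul_tsum` — `G_{ℚ_p}` acts on `ℚ̄_p = PadicAlgCl p` by
  ISOMETRIES (its norm is the spectral norm, Mathlib `spectralNorm_eq_of_equiv`), hence continuously and through every `tsum`
  (convergent or not: `Function.LeftInverse.map_tsum`);
* `zCoord_map` — the local parameter `z = -x/y` (`WeierstrassCurve.Affine.Point.zCoord`) commutes with `Point.map`.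

Theorems only (no `def`, no fact, no instance); standard axioms. Nothing here moves the crux; BSD is not advanced by this file.
-/

noncomputable section

open scoped Topology

set_option linter.dupNamespace false

namespace Summit.BirchSwinnertonDyer.BirchSwinnertonDyer.Theorems.SignedKatoOffTwo.FrameChange

open Literature.AnabelianGeometry.AbsoluteAnabelian.AbsTopIII

variable {p : ℕ} [Fact p.Prime]

/-! ## Rigidity of `ℚ_p`: the completion isomorphism `φ` is unique -/

/-- **`Aut(ℚ_p) = 1`, equivalence form.** Any two ring isomorphisms `ℚ_p ≃+* K` are equal: their quotient is a ring
endomorphism of `ℚ_p`, which is the identity (`padicRingHom_self_eq_id`). [folklore] -/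
theorem padicRingEquiv_eq {K : Type*} [NonAssocSemiring K] (φ φ' : ℚ_[p] ≃+* K) : φ = φ' := by
  have h := padicRingHom_self_eq_id (p := p) (φ.trans φ'.symm).toRingHom
  ext y
  have hy := congrArg (fun f : ℚ_[p] →+* ℚ_[p] => φ' (f y)) h
  simpa using hy

/-- **`Aut(ℚ_p) = 1`, pointwise form.** [folklore] -/
theorem padicRingEquiv_apply_eq {K : Type*} [NonAssocSemiring K] (φ φ' : ℚ_[p] ≃+* K) (y : ℚ_[p]) :
    φ y = φ' y := by
  rw [padicRingEquiv_eq φ φ']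

/-! ## Two continuous frames differ by an element of `G_{ℚ_p}` -/

/-- **Frame change.** Let `Ω` be a field with a ring homomorphism `ι₀ : K →+* Ω` (think `Ω = \overline{ℚ_v}`,
`K = ℚ_v`, `ι₀ = algebraMap`), and let `Φ, Φ₀ : ℚ̄_p ≃ₐ[ℚ] Ω` be two frames CONTINUOUS in the sense of the fact p640688:
`Φ ∘ algebraMap = ι₀ ∘ φ`, `Φ₀ ∘ algebraMap = ι₀ ∘ φ₀` for ring isomorphisms `φ, φ₀ : ℚ_p ≃+* K`. Then `φ = φ₀`
(`padicRingEquiv_eq`) and `ψ := Φ₀⁻¹ ∘ Φ` fixes `ℚ_p`, i.e. it is an element of the absolute Galois group `G_{ℚ_p}` with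
`Φ₀ (ψ • x) = Φ x`. [folklore] -/
theorem exists_gal_frameChange {K Ω : Type*} [Field K] [Field Ω] [Algebra ℚ Ω] (ι₀ : K →+* Ω)
    (Φ Φ₀ : AlgebraicClosure ℚ_[p] ≃ₐ[ℚ] Ω) (φ φ₀ : ℚ_[p] ≃+* K)
    (hΦ : ∀ y : ℚ_[p], Φ (algebraMap ℚ_[p] (AlgebraicClosure ℚ_[p]) y) = ι₀ (φ y))
    (hΦ₀ : ∀ y : ℚ_[p], Φ₀ (algebraMap ℚ_[p] (AlgebraicClosure ℚ_[p]) y) = ι₀ (φ₀ y)) :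
    ∃ ψ : Field.absoluteGaloisGroup ℚ_[p], ∀ x : AlgebraicClosure ℚ_[p], Φ₀ (ψ • x) = Φ x := by
  have hcomm : ∀ y : ℚ_[p], (Φ.trans Φ₀.symm).toRingEquiv (algebraMap ℚ_[p] (AlgebraicClosure ℚ_[p]) y) =
      algebraMap ℚ_[p] (AlgebraicClosure ℚ_[p]) y := by
    intro y
    change Φ₀.symm (Φ (algebraMap ℚ_[p] (AlgebraicClosure ℚ_[p]) y)) = _
    rw [hΦ, padicRingEquiv_apply_eq φ φ₀ y, ← hΦ₀, AlgEquiv.symm_apply_apply]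
  refine ⟨(Field.absoluteGaloisGroup.toAlgEquiv ℚ_[p]).symm
    (AlgEquiv.ofRingEquiv (f := (Φ.trans Φ₀.symm).toRingEquiv) hcomm), fun x => ?_⟩
  rw [Field.absoluteGaloisGroup.toAlgEquiv_symm_apply, AlgEquiv.ofRingEquiv_apply]
  change Φ₀ (Φ₀.symm (Φ x)) = Φ x
  exact AlgEquiv.apply_symm_apply _ _

/-! ## `G_{ℚ_p}` acts on `ℚ̄_p` by isometries -/

/-- The action of `σ ∈ G_{ℚ_p}` on `ℚ̄_p = PadicAlgCl p` is application of the underlying `ℚ_p`-algebra automorphism.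
[folklore] -/
theorem gal_smul_eq (σ : Field.absoluteGaloisGroup ℚ_[p]) (x : PadicAlgCl p) :
    σ • x = Field.absoluteGaloisGroup.toAlgEquiv ℚ_[p] σ x := rfl

/-- **`G_{ℚ_p}` acts by isometries on `ℚ̄_p`**: the norm of `PadicAlgCl p` is the spectral norm, invariant under
`ℚ_p`-algebra automorphisms (Mathlib `spectralNorm_eq_of_equiv`). [folklore] -/
theorem norm_gal_smul (σ : Field.absoluteGaloisGroup ℚ_[p]) (x : PadicAlgCl p) : ‖σ • x‖ = ‖x‖ := by
  rw [gal_smul_eq, ← PadicAlgCl.spectralNorm_eq, ← PadicAlgCl.spectralNorm_eq, ← spectralNorm_eq_of_equiv]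

/-- The valuation of `ℚ̄_p` is `G_{ℚ_p}`-invariant. [folklore] -/
theorem valuation_gal_smul (σ : Field.absoluteGaloisGroup ℚ_[p]) (x : PadicAlgCl p) :
    Valued.v (σ • x) = Valued.v x := by
  rw [PadicAlgCl.valuation_def, PadicAlgCl.valuation_def]
  ext
  simp only [coe_nnnorm, norm_gal_smul]

/-- Each `σ ∈ G_{ℚ_p}` is an isometry of `ℚ̄_p`. [folklore] -/
theorem isometry_gal_smul (σ : Field.absoluteGaloisGroup ℚ_[p]) : Isometry (fun x : PadicAlgCl p => σ • x) := by
  refine Isometry.of_dist_eq fun x y => ?_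
  rw [dist_eq_norm, dist_eq_norm, ← smul_sub, norm_gal_smul]

/-- Each `σ ∈ G_{ℚ_p}` acts continuously on `ℚ̄_p`. [folklore] -/
theorem continuous_gal_smul (σ : Field.absoluteGaloisGroup ℚ_[p]) : Continuous (fun x : PadicAlgCl p => σ • x) :=
  (isometry_gal_smul σ).continuous

/-- **`G_{ℚ_p}` passes through every `tsum` in `ℚ̄_p`** — summable or not (a non-summable family stays non-summable,
both sides are `0`): `σ` is a continuous additive bijection with continuous inverse (`Function.LeftInverse.map_tsum`).
[folklore] -/
theorem gal_smul_tsum {ι : Type*} (σ : Field.absoluteGaloisGroup ℚ_[p]) (f : ι → PadicAlgCl p) :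
    σ • (∑' i, f i) = ∑' i, σ • f i := by
  simp only [gal_smul_eq]
  refine Function.LeftInverse.map_tsum f (g := Field.absoluteGaloisGroup.toAlgEquiv ℚ_[p] σ)
    (g' := Field.absoluteGaloisGroup.toAlgEquiv ℚ_[p] σ⁻¹) ?_ ?_ fun x => ?_
  · exact continuous_gal_smul σ
  · exact continuous_gal_smul σ⁻¹
  · change σ⁻¹ • σ • x = x
    rw [inv_smul_smul]

/-- `G_{ℚ_p}` fixes `ℚ_p ⊂ ℚ̄_p`. [folklore] -/
theorem gal_smul_algebraMap (σ : Field.absoluteGaloisGroup ℚ_[p]) (y : ℚ_[p]) :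
    σ • algebraMap ℚ_[p] (PadicAlgCl p) y = algebraMap ℚ_[p] (PadicAlgCl p) y := by
  rw [gal_smul_eq, AlgEquiv.commutes]

/-! ## The local parameter `z = -x/y` commutes with `Point.map` -/

/-- `z(f_* P) = f (z(P))` for the local parameter `z = -x/y` at `O` (`z(O) = 0`). [folklore] -/
theorem zCoord_map {R S F K : Type*} [CommRing R] [CommRing S] [Field F] [Field K] [DecidableEq F] [DecidableEq K]
    [Algebra R S] [Algebra R F] [Algebra S F] [IsScalarTower R S F] [Algebra R K] [Algebra S K] [IsScalarTower R S K]
    {W : WeierstrassCurve R}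
    (f : F →ₐ[S] K) (P : (W.baseChange F).toAffine.Point) :
    (WeierstrassCurve.Affine.Point.map (W' := W) f P).zCoord = f P.zCoord := by
  rcases P with _ | ⟨x, y, h⟩
  · rw [← WeierstrassCurve.Affine.Point.zero_def, WeierstrassCurve.Affine.Point.map_zero,
      WeierstrassCurve.Affine.Point.zCoord_zero, WeierstrassCurve.Affine.Point.zCoord_zero, map_zero]
  · rw [WeierstrassCurve.Affine.Point.map_some, WeierstrassCurve.Affine.Point.zCoord_some,
      WeierstrassCurve.Affine.Point.zCoord_some, map_div₀, map_neg]

end Summit.BirchSwinnertonDyer.BirchSwinnertonDyer.Theorems.SignedKatoOffTwo.FrameChange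

end
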